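import Literature.Computability.AlgebraicComplexity.AlmanLi2026SpectrumMatMul
import Literature.Computability.AlgebraicComplexity.AlmanLi2026IteratedCW
import HarnessLib

/-!
# Strassen calculus for the iterated identity (Alman–Li 2026, §7.1: `R̃(cw_q) ≤ max_θ F(θ)`)

Topic `Literature/Computability/AlgebraicComplexity` (family `MatrixMultiplication`). Source: J. Alman,
B. Li, *Asymptotic Rank Speedup Theorems, Revisited*, arXiv:2605.21738 (2026), §7.1 (held text
`paper:arxiv-2605.21738`, p0017 L100–122): after the iterated degeneration
`cw_q^{⊗2n} ⊕ 2⊙cw_q^{⊗n}⊗⟨1,t,1⟩ ⊕ ⟨1,t²+2(q+1)^{2n},1⟩ ⊴ (⟨(q+2)^n⟩ ⊕ ⟨1,q^n,1⟩)^{⊗2}`,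
"Strassen calculus then gives the upper bound `R̃(cw_q) ≤ max_{θ∈[2/3,1]} F(θ)` where
`F(θ) ≔ sqrt((r+s^θ)² − (t²+2(q+1)^{2n})^θ + t^{2θ}) − t^θ` with `r = (q+2)^n`, `s = q^n`, and
`t = r+s−2(q+1)^n`. … (computed via computer-aided evaluation; in fact, the maximizing `θ` … equals
`θ = 2/3`)."  [The printed `R̃(cw_q)` here abbreviates the bound on `R̃(cw_q)^n`, cf. Table 1's
fourth roots.]

This file proves that step GENERICALLY and in CERTIFICATE form (no named facts):
* `AlmanLi2026.asymptoticRank_le_of_iterated_certificate`: for any tensor `T` over a field with the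
  three-direction iterated degenerations
  `(⟨r⟩ ⊕ L_s)^{⊠2} ⊵ T^{⊠2n} ⊕ ⟨2⟩⊠(T^{⊠n}⊠L_t) ⊕ L_{t'}` (`L_m` the one-line matrix multiplication
  tensor `⟨m,1,1⟩ / ⟨1,m,1⟩ / ⟨1,1,m⟩` of the direction) and any `c ≥ 0` with
  `(r + s^θ)² ≤ c² + 2c·t^θ + t'^θ` for all `θ ∈ [2/3, 1]` — equivalently `F(θ) ≤ c` on `[2/3,1]`
  for the printed `F` — one has `R̃(T) ≤ c^{1/n}`.  Printed argument: apply a universal spectral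
  point `φ` (exponents `θᵢ ∈ [0,1]`, `∑θᵢ ≥ 2`, Prop. 4.2): `X² + 2t^{θᵢ}X + t'^{θᵢ} ≤ (r+s^{θᵢ})²`
  with `X = φ(T)^n`; take the direction with the largest `θᵢ ≥ 2/3`; then Strassen duality.
* `AlmanLi2026.asymptoticRank_cwTensor_le_of_iterated_certificate`: the same for `cw_q` over `ℂ`,
  taking the tree's fact `AlmanLi2026_iteratedSpeedup_cw` (the §7.1 display) as a hypothesis.
The numerical maximisation (Table 1: `γ'_2 = 3.931`, Thm. 1.3) is NOT done here: it needs a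
certificate `c` valid on the whole interval `[2/3,1]`.

## References

* J. Alman, B. Li, *Asymptotic Rank Speedup Theorems, Revisited*, arXiv:2605.21738 (2026), §7.1
  (p0017 L100–122), Prop. 4.2, Prop. 4.5. [AlmanLi2026]
-/

noncomputable section

open scoped BigOperators

namespace Literature.Computability.AlgebraicComplexity

section IteratedSpectrum

variable {K : Type} [Field K]
variable {ι κ μ : Type} [Fintype ι] [Fintype κ] [Fintype μ]

/-- Solving the quadratic: `X² + 2bX ≤ c² + 2bc` with `X, b, c ≥ 0` forces `X ≤ c`. [folklore] -/
private theorem le_of_sq_add_le {X b c : ℝ} (hb : 0 ≤ b) (hc : 0 ≤ c)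
    (h : X ^ 2 + 2 * b * X ≤ c ^ 2 + 2 * b * c) : X ≤ c := by
  by_contra hlt
  have hlt' : c < X := lt_of_not_ge hlt
  nlinarith [mul_pos (by linarith : (0:ℝ) < X - c) (by linarith : (0:ℝ) < X + c + 2 * b)]

/-- **Alman–Li 2026, §7.1 — Strassen calculus on the iterated identity, certificate form.**
Let `T` be a tensor over a field and suppose, in each of the three directions (`⟨·,1,1⟩`,
`⟨1,·,1⟩`, `⟨1,1,·⟩`), the iterated degeneration
`(⟨r⟩ ⊕ L_s) ⊠ (⟨r⟩ ⊕ L_s) ⊵ T^{⊠2n} ⊕ ⟨2⟩ ⊠ (T^{⊠n} ⊠ L_t) ⊕ L_{t'}` (`s, t, t' ≥ 1`). If `c ≥ 0`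
satisfies `(r + s^θ)² ≤ c² + 2c t^θ + t'^θ` for every `θ ∈ [2/3, 1]` (i.e. `F(θ) ≤ c` there, `F`
the printed function), then `R̃(T) ≤ c^{1/n}`. [cite: AlmanLi2026, §7.1 (Strassen calculus after Thm. 6.2; Props. 4.2, 4.5)] -/
theorem AlmanLi2026.asymptoticRank_le_of_iterated_certificate (T : ι → κ → μ → K)
    {r s t t' n : ℕ} (hn : 1 ≤ n) (hs : 1 ≤ s) (ht : 1 ≤ t) (ht' : 1 ≤ t')
    (h₁ : AlgDegeneratesTo
      (kroneckerTensor (directSumTensor (unitTensor K r) (matMulTensor K s 1 1))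
        (directSumTensor (unitTensor K r) (matMulTensor K s 1 1)))
      (directSumTensor (kroneckerPow T (2 * n)) (directSumTensor
        (kroneckerTensor (unitTensor K 2) (kroneckerTensor (kroneckerPow T n) (matMulTensor K t 1 1)))
        (matMulTensor K t' 1 1))))
    (h₂ : AlgDegeneratesTo
      (kroneckerTensor (directSumTensor (unitTensor K r) (matMulTensor K 1 s 1))
        (directSumTensor (unitTensor K r) (matMulTensor K 1 s 1)))
      (directSumTensor (kroneckerPow T (2 * n)) (directSumTensor
        (kroneckerTensor (unitTensor K 2) (kroneckerTensor (kroneckerPow T n) (matMulTensor K 1 t 1)))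
        (matMulTensor K 1 t' 1))))
    (h₃ : AlgDegeneratesTo
      (kroneckerTensor (directSumTensor (unitTensor K r) (matMulTensor K 1 1 s))
        (directSumTensor (unitTensor K r) (matMulTensor K 1 1 s)))
      (directSumTensor (kroneckerPow T (2 * n)) (directSumTensor
        (kroneckerTensor (unitTensor K 2) (kroneckerTensor (kroneckerPow T n) (matMulTensor K 1 1 t)))
        (matMulTensor K 1 1 t'))))
    {c : ℝ} (hc : 0 ≤ c)
    (hcert : ∀ θ : ℝ, 2 / 3 ≤ θ → θ ≤ 1 →
      ((r : ℝ) + (s : ℝ) ^ θ) ^ 2 ≤ c ^ 2 + 2 * c * (t : ℝ) ^ θ + (t' : ℝ) ^ θ) :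
    asymptoticRank T ≤ c ^ ((n : ℝ)⁻¹) := by
  refine strassen_duality_asymptoticRank.asymptoticRank_le (strassen_duality_asymptoticRank_holds K) T
    fun F hF => ?_
  have hT0 : 0 ≤ F T := hF.nonneg T
  -- evaluate the three degenerations at `φ = F`
  have e₁ := hF.mono_of_algDegeneratesTo h₁
  have e₂ := hF.mono_of_algDegeneratesTo h₂
  have e₃ := hF.mono_of_algDegeneratesTo h₃
  simp only [hF.map_kronecker, hF.map_directSum, hF.map_unitTensor, hF.map_kroneckerPow] at e₁ e₂ e₃
  rw [hF.map_matMulTensor_line₁ hs, hF.map_matMulTensor_line₁ ht, hF.map_matMulTensor_line₁ ht'] at e₁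
  rw [hF.map_matMulTensor_line₂ hs, hF.map_matMulTensor_line₂ ht, hF.map_matMulTensor_line₂ ht'] at e₂
  rw [hF.map_matMulTensor_line₃ hs, hF.map_matMulTensor_line₃ ht, hF.map_matMulTensor_line₃ ht'] at e₃
  set θ := specMMPoint K F with hθdef
  -- the direction with the largest exponent, `θ i₀ ≥ 2/3`
  obtain ⟨i₀, -, hi₀⟩ := Finset.exists_max_image Finset.univ θ Finset.univ_nonempty
  have hle_max : 2 / 3 ≤ θ i₀ := by
    have hsum : 2 ≤ ∑ i, θ i := AlmanLi2026.prop42_two_le_sum hF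
    have h3 : ∑ i, θ i ≤ 3 * θ i₀ := by
      rw [Fin.sum_univ_three]
      linarith [hi₀ 0 (Finset.mem_univ _), hi₀ 1 (Finset.mem_univ _), hi₀ 2 (Finset.mem_univ _)]
    linarith
  have hmax_le : θ i₀ ≤ 1 := (AlmanLi2026.prop42_mem_Icc hF i₀).2
  -- the quadratic inequality in `X = φ(T)^n` for that direction
  set X := F T ^ n with hX
  have hX0 : 0 ≤ X := pow_nonneg hT0 n
  have hpow2 : F T ^ (2 * n) = X ^ 2 := by rw [hX, ← pow_mul, mul_comm]
  have hquad : X ^ 2 + 2 * (t : ℝ) ^ θ i₀ * X + (t' : ℝ) ^ θ i₀ ≤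
      ((r : ℝ) + (s : ℝ) ^ θ i₀) ^ 2 := by
    fin_cases i₀
    · change X ^ 2 + 2 * (t : ℝ) ^ θ 0 * X + (t' : ℝ) ^ θ 0 ≤ ((r : ℝ) + (s : ℝ) ^ θ 0) ^ 2
      rw [hpow2] at e₁; push_cast at e₁ ⊢; nlinarith [e₁]
    · change X ^ 2 + 2 * (t : ℝ) ^ θ 1 * X + (t' : ℝ) ^ θ 1 ≤ ((r : ℝ) + (s : ℝ) ^ θ 1) ^ 2
      rw [hpow2] at e₂; push_cast at e₂ ⊢; nlinarith [e₂]
    · change X ^ 2 + 2 * (t : ℝ) ^ θ 2 * X + (t' : ℝ) ^ θ 2 ≤ ((r : ℝ) + (s : ℝ) ^ θ 2) ^ 2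
      rw [hpow2] at e₃; push_cast at e₃ ⊢; nlinarith [e₃]
  have hcθ := hcert (θ i₀) hle_max hmax_le
  have hb : 0 ≤ (t : ℝ) ^ θ i₀ := Real.rpow_nonneg (Nat.cast_nonneg t) _
  have hXc : X ≤ c := le_of_sq_add_le hb hc (by linarith)
  -- `φ(T) = (φ(T)^n)^{1/n} ≤ c^{1/n}`
  have hn0 : (n : ℝ) ≠ 0 := by exact_mod_cast (show n ≠ 0 by omega)
  calc F T = (F T ^ n) ^ ((n : ℝ)⁻¹) := by
        rw [← Real.rpow_natCast, ← Real.rpow_mul hT0, mul_inv_cancel₀ hn0, Real.rpow_one]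
    _ ≤ c ^ ((n : ℝ)⁻¹) := Real.rpow_le_rpow hX0 hXc (inv_nonneg.2 (Nat.cast_nonneg n))

end IteratedSpectrum

/-- **Alman–Li 2026, §7.1, for `cw_q` over `ℂ`**: assuming the iterated display (the tree's named
fact `AlmanLi2026_iteratedSpeedup_cw`), every certificate `c ≥ 0` with
`((q+2)^n + (q^n)^θ)² ≤ c² + 2c·t^θ + (t² + 2(q+1)^{2n})^θ` on `θ ∈ [2/3,1]`
(`t = (q+2)^n + q^n − 2(q+1)^n ≥ 1`, `2(q+1)^n < (q+2)^n`) gives `R̃(cw_q) ≤ c^{1/n}`.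
The printed Table 1 value `γ'_2 = 3.931` (Thm. 1.3) is `c^{1/4}` for the best certificate at
`q = 2, n = 4`; supplying that certificate is separate numerical work.
[cite: AlmanLi2026, §7.1 (display after Cor. 7.1 and Table 1)] -/
theorem AlmanLi2026.asymptoticRank_cwTensor_le_of_iterated_certificate
    (hfact : AlmanLi2026_iteratedSpeedup_cw) {q n t : ℕ} (hq : 2 ≤ q) (hn : 1 ≤ n)
    (hlt : 2 * (q + 1) ^ n < (q + 2) ^ n) (ht : (q + 2) ^ n + q ^ n = 2 * (q + 1) ^ n + t)
    {c : ℝ} (hc : 0 ≤ c)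
    (hcert : ∀ θ : ℝ, 2 / 3 ≤ θ → θ ≤ 1 →
      ((((q + 2) ^ n : ℕ) : ℝ) + ((q ^ n : ℕ) : ℝ) ^ θ) ^ 2 ≤
        c ^ 2 + 2 * c * (t : ℝ) ^ θ + (((t ^ 2 + 2 * (q + 1) ^ (2 * n) : ℕ) : ℝ)) ^ θ) :
    asymptoticRank (cwTensor ℂ q) ≤ c ^ ((n : ℝ)⁻¹) := by
  obtain ⟨h₂, h₃, h₁⟩ := hfact q n t hq hn hlt ht
  have hs : 1 ≤ q ^ n := Nat.one_le_pow _ _ (by omega)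
  have ht1 : 1 ≤ t := by
    -- `t ≥ (q+2)^n − 2(q+1)^n + q^n ≥ 1` since `2(q+1)^n < (q+2)^n`
    have := Nat.one_le_pow n q (by omega)
    omega
  have ht'1 : 1 ≤ t ^ 2 + 2 * (q + 1) ^ (2 * n) :=
    (Nat.one_le_pow 2 t ht1).trans (Nat.le_add_right _ _)
  exact AlmanLi2026.asymptoticRank_le_of_iterated_certificate (cwTensor ℂ q) hn hs ht1 ht'1
    h₁ h₂ h₃ hc hcert

end Literature.Computability.AlgebraicComplexity
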